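import Summits.QuantumAdvantage.QuantumAdvantage.Theses.ArithStatLadder
import Summits.QuantumAdvantage.QuantumAdvantage.Theorems.ArithStatLadderIqThreeNotPPoly
import Summits.QuantumAdvantage.QuantumAdvantage.Theorems.ArithStatLadderIqThreeNotPPolyStubOneSidedNagell
import Summits.QuantumAdvantage.QuantumAdvantage.Theorems.ArithStatLadderIqThreeNotPPolyStubSqfreeProductNagell
import Summits.QuantumAdvantage.QuantumAdvantage.Theorems.ArithStatLadderIqThreeNotPPolyStubDensityNagell
import Summits.QuantumAdvantage.QuantumAdvantage.Theorems.ArithStatLadderIqThreeNotPPolyStubNagellData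
import Summits.QuantumAdvantage.QuantumAdvantage.Theorems.ArithStatLadderIqThreeNotPPolyStubNagellThreeTorsion
import Summits.QuantumAdvantage.QuantumAdvantage.Theorems.ArithStatLadderIqThreeNotPPolyStubSamplerNagellFP
import Literature.NumberTheory.QuadraticFields.ThreeTorsion
import Summits.QuantumAdvantage.QuantumAdvantage.Theorems.ArithStatLadderIqThreeNotPPolyStubInfluenceTail
import Summits.QuantumAdvantage.QuantumAdvantage.Theorems.ArithStatLadderIqThreeNotPPolyStubInfluenceAC0
import Summits.QuantumAdvantage.QuantumAdvantage.Theorems.ArithStatLadderIqThreeNotPPolyStubShiftPairsCount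
import Summits.QuantumAdvantage.QuantumAdvantage.Theorems.ArithStatLadderIqThreeNotPPolyStubShiftPairsCube
import Summits.QuantumAdvantage.QuantumAdvantage.Theorems.ArithStatLadderIqThreeNotPPolyStubShiftPairsCountFive
import Summits.QuantumAdvantage.QuantumAdvantage.Theorems.ArithStatLadderIqThreeNotPPolyApexBQP
import Summits.QuantumAdvantage.QuantumAdvantage.Theorems.IqThreeNotPPoly.Negative.GenusTwoParity

/-!
# Line `Sketch` for the crux `ArithStatLadder.IqThreeNotPPoly` (stmt-QuantumAdvantage-2422)

Skeleton v9 = c5 FINAL (continuation lead `prover-line-stmt-QuantumAdvantage-2422-c5-0`). The crux composition is UNCHANGED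
(one open stub, the apex `stub_sqfreeNotPPoly`, hypothesis-type). c5 registered FIVE RUNG STUBS R1–R5 (section "RUNG (c5)" at
the end) and ALL FIVE LANDED (wave 1: p122608 `stub_influenceTail`, p122737 `stub_influenceAC0`, p123405 `stub_shiftPairsCount`,
p122947 `stub_shiftPairsCube`; wave 2: p124143 `stub_shiftPairsCountFive`; imported below), so the kernel-checked compositions
`squarefree_not_mem_AC0_of` / `iqTwo_not_mem_AC0_of` are sorry-free: the apex's first UNCONDITIONAL rung
**`SQUAREFREES ∉ AC⁰`** (Bernasconi–Damm–Shparlinski 2000), `FUND ∉ AC⁰`, and the `ℓ = 2` ANALOGUE OF THE CRUX AGAINST `AC⁰`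
(`bin {d : −d fund ∧ 2 ∣ h(−d)} ∉ AC⁰`) — tree files `Theorems/ArithStatLadderIqThreeNotPPolyApexAC0.lean` (p123851 ACCEPTED:
`squarefree_not_mem_AC0`, `fund_not_mem_AC0`) and `…ApexAC0IqTwo.lean` (`iqTwo_not_mem_AC0`). Stubs: closed A–F + conclusions +
R1–R5 / open apex (never staffed) / delegated none / STUCK stub_sqfreeNotPPoly (`⊢ bin {m | Squarefree m} ∉ PPoly`).

Skeleton v10 = c4 FINAL (continuation lead `prover-line-stmt-QuantumAdvantage-2422-c4-0`; stubs UNCHANGED — the one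
registered open stub is the apex `stub_sqfreeNotPPoly`; wave: none, 1 stub left, crux-sized). What c4
adds is WHAT THE APEX IS WORTH, landed `--supports` as
`Theorems/ArithStatLadderIqThreeNotPPolyApexBQP.lean` (p117348, ACCEPTED): `squarefree_mem_BQP` —
**`SQUAREFREES ∈ BQP` unconditionally** (two-branch Karp reduction `SQF ≤ₚ FUND`, `m ↦ m | 4m`, into the
landed `IqThreeMemBQP.fund_mem_BQP`), hence **the apex ALONE closes the summit**:
`quantumAdvantage_of_squarefree_not_mem_PPoly : SQF ∉ P/poly → QuantumAdvantage` and
`quantumAdvantage_of_squarefree_not_mem_BPP : SQF ∉ BPP → QuantumAdvantage` — under either squarefree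
apex (this line's, or crux 14864's `stub_sqfreeNotBPP`) the witness `IQ3` and crux 2424 `IqThreeMemBQP`
are REDUNDANT (`closes_inputs_of_squarefree_not_mem_PPoly : apex → IqThreeNotPPoly ∧ IqThreeNotBPP ∧
QuantumAdvantage`); also `FUND ≤ₚ SQF`, `fund_mem_PPoly_iff_squarefree_mem_PPoly`,
`iqThreeNotPPoly_of_fund_not_mem_PPoly`. Second file: `…ApexSplit.lean` — the EXACT SPLIT `IqThreeNotPPoly ↔ (SQF ∉ P/poly) ∨ PromiseX` (PromiseX verbatim
the disprover's `PromiseIqThreeNotPPoly`), `X → QuantumAdvantage ∨ PromiseX`, and the re-topped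
assembly `IqThreeMemBQP → PromiseX → QuantumAdvantage` — `…ApexSplit.lean`, p118001, ACCEPTED.
Third and fourth files, BOTH ACCEPTED: `…ApexMinFac.lean` (p117750,
`exists_minFac_adPres`: the least prime factor by binary search over the `FACT` oracle, a presented
adaptive program in the `AdQuery.AdPres` algebra) and `…ApexFactoring.lean` (p118006,
`squarefree_polyTimeTuringReducible_FACT` — **`SQF ≤ᵀₚ FACT`** — hence
`squarefree_mem_PPoly_of_FACT_mem_PPoly`, `squarefree_mem_BPP_of_FACT_mem_BPP`, and BY NAME
`clbFactNotPpoly_of_squarefree_not_mem_PPoly : apex → CircuitLB.ClbFactNotPpoly`,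
`shorThesis_of_squarefree_not_mem_BPP : SQF ∉ BPP → Shor.ShorThesis`): the squarefree apexes of cruxes
2422 / 14864 are AT LEAST AS STRONG AS the factoring routes' theses. Planner-facing (D-0014): X as
typed = (factoring-family apex ⊒ ShorThesis, which gives the summit for free via Shor) ∨ (promise
core); re-top the route on the promise core `PromiseIqThreeNotPPoly`.

v6 (continuation lead `prover-line-stmt-QuantumAdvantage-2422-c3-0`; stubs UNCHANGED from v5 —
the one registered open stub is the apex `stub_sqfreeNotPPoly`). What c3 adds lives on the negative /
strength side and is landed as `--supports` Theorems files, not in this skeleton: the CRUX'S OWN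
separation strength made hypothesis-free by CONSTRUCTING the folklore `IQ3 ∈ PSPACE` (indeed
`IQ3 ∈ P^{#P}`) that `Negative.RefutationShape.PSPACE_not_subset_PPoly_of` assumed —
`ArithStatLadderIqThreeNotPPolyPairTests.lean` (p110328, brick compiler on pairs),
`…ClassNumberSharpP.lean` (p111455, `classNumber_negVal_mem_SharpP`: `w ↦ h(−⟦w⟧)` is a `#P` function,
by counting reduced forms `(a, t − a, c)` in three `(|w|+1)`-bit blocks), `…MemPSPACE.lean` (p115171,
`iqThreeLang_mem_PSPACE`; `IqThreeNotPPoly → PSPACE ⊄ P/poly`), `…MemPSharpP.lean` (p115201,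
`iqThreeLang_mem_PSharpP`, one `#P` query; `IqThreeNotPPoly → P^{#P} ⊄ P/poly`) — all ACCEPTED. So X is bracketed by
kernel-checked separations: `SQF ∉ P/poly ⇒ X ⇒ P^{#P} ⊄ P/poly`, and `SQF ∉ P/poly ⇒ NP ⊄ P/poly`.

v5 (continuation lead `prover-line-stmt-QuantumAdvantage-2422-c2-0`): **NAGELL PLANTING,
INTEGRATED**. STATUS: the line is COMPLETE MODULO ITS APEX. All six provable stubs are accepted
Theorems files and imported — A `stub_samplerNagellFP` p101148, B `stub_oneSidedNagell` p100537,
C `stub_sqfreeProductNagell` p100632, D `stub_densityNagell` p100932, E `stub_nagellData` p100631,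
F `stub_nagellThreeTorsion` p100799 — and so are BOTH conclusion files:
`ArithStatLadderIqThreeNotPPolyNagellSixFree.lean` (p106985, lead c1:
`toLanguage_squarefree_mem_PPoly_of_iqThree_nagell : IQ3 ∈ P/poly → SQF ∈ P/poly`, unconditional;
v4.2 registered its signature as a stub for the `--supports` landing — v5 closes it by this file's
own cone instead, so it is no longer a stub) and `ArithStatLadderIqThreeNotPPolyNagell.lean` (gen-1
lead `…-2422-1`, parallel Nagell sampler: `iqThreeNotPPoly_of_sqfreeNotPPoly : SQF ∉ P/poly →
IqThreeNotPPoly`, unconditional; uniform twin `iqThreeNotBPP_of_sqfreeNotBPP` in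
`ArithStatLadderIqThreeNotPPolyUniformFloor.lean`). THE ONE REGISTERED OPEN STUB is the apex X
`stub_sqfreeNotPPoly : bin {m | Squarefree m} ∉ P/poly` (hypothesis-type, never staffed): an
explicit super-polynomial circuit lower bound, of separation strength — kernel-checked in
`Theorems/ArithStatLadderIqThreeNotPPolyApexNP.lean` (p108496, lead c2): `SQUAREFUL ∈ NP`
(`squarefree_compl_mem_NP`), so the apex gives `NP ⊄ P/poly`
(`NP_not_subset_PPoly_of_squarefree_not_mem_PPoly`) and `P ≠ NP`; natural-proofs-barred under hard
PRGs exactly like the crux. wave: none (one stub left, crux-sized) — outcome `promote-stub`.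
v3 (lead `…-2422-0`) closed the crux modulo {Hasse's class-field-theoretic dictionary
(`stub_hasseDictionary`, named fact p91325), the apex `SQUAREFREES ∉ P/poly`}. v4 REMOVES the
class-field-theoretic socket: the planted binary cubic form (whose cubic FIELD of discriminant `−d`
needs Hasse 1930 / CFT to force `3 ∣ h(−d)`) is replaced by a planted NORM EQUATION
`y² + d = 4a³` (Nagell 1922): the ideal `𝔞 = (a, (y + √−d)/2)` of `ℚ(√−d)` has `𝔞³ = ((y+√−d)/2)`
and is not principal when `1 < a`, `4a < d` — an EXPLICIT ideal class of order `3`, elementary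
(Dedekind), so `3 ∣ h(−d)` with no class field theory. Everything else (RUR closure p91021, the
`FP` guard p86414, the AP squarefree sieve p89304) is landed and reused.

## The line in one paragraph

SQUAREFREE-FILTER DOMINATION, CFT-free. The crux is literally `IQ3 ∉ P/poly`, `IQ3 = bin S`,
`S = {d : −d fundamental ∧ 3 ∣ h(−d)}`. The line proves `SQF ∉ P/poly → IQ3 ∉ P/poly`
UNCONDITIONALLY through a one-sided randomized polynomial-time reduction `SQF ≤_RUR IQ3` with
success `≥ 1/4` and the landed closure `mem_PPoly_of_rurReduction`. THE SAMPLER: on `N = ⟦x⟧` and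
seed value `j` put `G = N / gcd(N, 6)`, `t = 1 + 11G + 11G² + 30Gj` (odd, `≡ 1 (mod G)`, with
`Gt ≡ 2 (mod 3)` and `Gt ≢ 2 (mod 5)` built in) and output
`d = G t · (G t + 8) · (4 G t + 27) = 4k³ − (7k − 9)²`, `k = 9 + G t`.
NO side (exact, `stub_oneSidedNagell`): `p² ∣ N`, `p ≥ 5` ⇒ `p² ∣ G ∣ d`; `9 ∣ N ⇒ 3 ∣ G ⇒ 9 ∣ d`;
`4 ∣ N ⇒ 2 ∣ G ⇒ −d ≡ 0 (mod 4)` with `−d/4 ≡ 0, 1 (mod 4)`: never fundamental. YES side: for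
squarefree `N`, `G` is squarefree, odd, prime to `3`, and `d` is squarefree as soon as the three
arithmetic progressions `t`, `Gt + 8`, `4Gt + 27` (moduli `30G, 30G², 120G²`, coprime starts, all
primes `≥ 7` in play) are (`stub_sqfreeProductNagell`: pairwise coprimality is automatic), which by
the landed AP sieve fails for at most `3 · (1/6 + o(1))` of the `2^{4n+8}` seeds
(`stub_densityNagell`: `≥ 1/4` good seeds). A squarefree `d` of this shape is `≡ 3 (mod 4)`, so
`−d` is fundamental, and carries the Nagell data `(a, y) = (k, 7k − 9)` (`stub_nagellData`); then
`3 ∣ h(−d)` by the explicit order-3 class (`stub_nagellThreeTorsion`, LEAD). With the apex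
`stub_sqfreeNotPPoly` the crux follows BY NAME (`IqThreeNotPPoly_of`).

## Disproof used (`Cruxes/IqThreeNotPPoly/Disproof.lean`, cdisprove cycles 1–2, NO KILL)

* the crux is `IQ3 ∉ P/poly` verbatim; this line's contrapositive `¬X ⇒ SQF ∈ P/poly` is now an
  UNCONDITIONAL floor under every refutation (Adleman–McCurley O8, non-uniformly);
* refuted strengthenings (SIZE(lupanov), `h = 1` mutation): no stub quantifies a size bound or uses
  `h = 1`; small model `h(−23) = 3` is the Nagell instance `a = 2, y = 3` (`9 + 23 = 32`);
* no `_false_without_` theorem exists; `-- Targets`: none on v4 stubs yet.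
-/

set_option linter.unusedVariables false
set_option linter.dupNamespace false

noncomputable section

namespace Summit.QuantumAdvantage.QuantumAdvantage.Cruxes.IqThreeNotPPoly.Sketch

open scoped Classical BigOperators
open _root_.Computability
open Literature.Computability.Complexity
open Literature.Computability.Cryptography (IsNegFundamentalDiscr)
open Literature.NumberTheory.QuadraticFields (BinaryQuadraticForm.classNumber)
open Summit.QuantumAdvantage.QuantumAdvantage.Theses.ArithStatLadder (IqThreeNotPPoly)
open Summit.QuantumAdvantage.QuantumAdvantage.Theorems.IqThreeNotPPoly
  (stub_natAdapter stub_apSieve mem_PPoly_of_rurReduction card_filter_seeds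
    encodeNat_mem_toLanguage_iff nil_not_mem_iqThreeLanguage not_isNegFundamentalDiscr_zero
    stub_oneSidedNagell stub_sqfreeProductNagell stub_densityNagell stub_nagellData
    stub_nagellThreeTorsion stub_samplerNagellFP
    stub_influenceTail stub_influenceAC0 stub_shiftPairsCount stub_shiftPairsCube
    isNegFundamentalDiscr_iff_squarefree_of_mod_four stub_shiftPairsCountFive)

/-! ## Vocabulary (verbatim the crux's set; no new notion enters a stub signature) -/

/-- The crux's set `S = {d : −d fundamental, 3 ∣ h(−d)}`. -/
def iqThreeSet : Set ℕ :=
  {d : ℕ | IsNegFundamentalDiscr d ∧ 3 ∣ BinaryQuadraticForm.classNumber (-(d : ℤ))}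

/-- `IQ3 = bin S`. -/
def iqThreeLang : Language Bool := encodingNatBool.toLanguage iqThreeSet

/-- `SQF = bin {m : m squarefree}`. -/
def sqfreeLang : Language Bool := encodingNatBool.toLanguage {m : ℕ | Squarefree m}

/-- The `6`-free core `G = N / gcd(N, 6)` of the modulus. -/
def core (N : ℕ) : ℕ := N / Nat.gcd N 6

/-- The planted parameter `t = 1 + 11G + 11G² + 30Gj`. -/
def nT (G j : ℕ) : ℕ := 1 + 11 * G + 11 * G ^ 2 + 30 * G * j

/-- The sampler's output `d = Gt (Gt + 8)(4Gt + 27) = 4k³ − (7k−9)²`, `k = 9 + Gt`. -/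
def nD (G j : ℕ) : ℕ := G * nT G j * (G * nT G j + 8) * (4 * (G * nT G j) + 27)

/-! ## The stub STATEMENTS (named `Prop`s over tree vocabulary) -/

/-- STUB A statement (the sampler is polynomial time): `⟨x, r⟩ ↦ bin d`, `N = ⟦x⟧`,
`G = N / gcd(N,6)`, `j = ⟦r⟧`. -/
def SamplerNagellFP : Prop :=
  ∃ f : List Bool → List Bool, f ∈ FP ∧ ∀ x r : List Bool,
    f (boolPair x r) = encodeNat
      ((bitsToNat x / Nat.gcd (bitsToNat x) 6) *
        (1 + 11 * (bitsToNat x / Nat.gcd (bitsToNat x) 6) +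
          11 * (bitsToNat x / Nat.gcd (bitsToNat x) 6) ^ 2 +
          30 * (bitsToNat x / Nat.gcd (bitsToNat x) 6) * bitsToNat r) *
        ((bitsToNat x / Nat.gcd (bitsToNat x) 6) *
          (1 + 11 * (bitsToNat x / Nat.gcd (bitsToNat x) 6) +
            11 * (bitsToNat x / Nat.gcd (bitsToNat x) 6) ^ 2 +
            30 * (bitsToNat x / Nat.gcd (bitsToNat x) 6) * bitsToNat r) + 8) *
        (4 * ((bitsToNat x / Nat.gcd (bitsToNat x) 6) *
          (1 + 11 * (bitsToNat x / Nat.gcd (bitsToNat x) 6) +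
            11 * (bitsToNat x / Nat.gcd (bitsToNat x) 6) ^ 2 +
            30 * (bitsToNat x / Nat.gcd (bitsToNat x) 6) * bitsToNat r)) + 27))

/-- STUB B statement (ONE-SIDEDNESS, exact): if `G` has a square prime factor, or is even, or is
divisible by `3`, the output is never a negative fundamental discriminant. -/
def OneSidedNagell : Prop :=
  ∀ (G j : ℕ), ((∃ p : ℕ, p.Prime ∧ p ^ 2 ∣ G) ∨ 2 ∣ G ∨ 3 ∣ G) →
    ¬ IsNegFundamentalDiscr (G * (1 + 11 * G + 11 * G ^ 2 + 30 * G * j) *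
      (G * (1 + 11 * G + 11 * G ^ 2 + 30 * G * j) + 8) *
      (4 * (G * (1 + 11 * G + 11 * G ^ 2 + 30 * G * j)) + 27))

/-- STUB C statement (ALGEBRA of the YES side): for `G` squarefree, odd, prime to `3`, the output
is squarefree as soon as its three moving factors are (pairwise coprimality is automatic). -/
def SqfreeProductNagell : Prop :=
  ∀ (G j : ℕ), Squarefree G → ¬ 2 ∣ G → ¬ 3 ∣ G →
    Squarefree (1 + 11 * G + 11 * G ^ 2 + 30 * G * j) →
    Squarefree (G * (1 + 11 * G + 11 * G ^ 2 + 30 * G * j) + 8) →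
    Squarefree (4 * (G * (1 + 11 * G + 11 * G ^ 2 + 30 * G * j)) + 27) →
      Squarefree (G * (1 + 11 * G + 11 * G ^ 2 + 30 * G * j) *
        (G * (1 + 11 * G + 11 * G ^ 2 + 30 * G * j) + 8) *
        (4 * (G * (1 + 11 * G + 11 * G ^ 2 + 30 * G * j)) + 27))

/-- STUB S statement (landed p89304, `stub_apSieve`): the elementary squarefree sieve in an
arithmetic progression. -/
def ApSieve : Prop :=
  ∀ (a q K p₀ : ℕ), 0 < q → Nat.Coprime a q → 2 ≤ p₀ →
    (∀ p : ℕ, p.Prime → ¬ p ∣ q → p₀ ≤ p) →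
      (p₀ - 1) * ((Finset.range K).filter (fun k => ¬ Squarefree (a + q * k))).card ≤
        K + (p₀ - 1) * Nat.sqrt (a + q * K)

/-- STUB D statement (YES-DENSITY `≥ 1/4`, from STUBS C and S): for `G` squarefree, odd, prime to
`3`, `0 < G < 2^n`, `n ≥ n₀`, at least a quarter of the `j < 2^{4n+8}` give a squarefree output. -/
def DensityNagell : Prop :=
  SqfreeProductNagell → ApSieve →
    ∃ n₀ : ℕ, ∀ n, n₀ ≤ n → ∀ G : ℕ, Squarefree G → ¬ 2 ∣ G → ¬ 3 ∣ G → 0 < G → G < 2 ^ n →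
      2 ^ (4 * n + 8) ≤ 4 * ((Finset.range (2 ^ (4 * n + 8))).filter (fun j =>
        Squarefree (G * (1 + 11 * G + 11 * G ^ 2 + 30 * G * j) *
          (G * (1 + 11 * G + 11 * G ^ 2 + 30 * G * j) + 8) *
          (4 * (G * (1 + 11 * G + 11 * G ^ 2 + 30 * G * j)) + 27)))).card

/-- STUB E statement (NAGELL DATA): a squarefree output is `≡ 3 (mod 4)` — so `−d` is fundamental —
and is `4a³ − y²` with `a = 9 + Gt > 1`, `y = 7a − 9` odd, `4a < d`. -/
def NagellData : Prop :=
  ∀ (G j : ℕ),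
    Squarefree (G * (1 + 11 * G + 11 * G ^ 2 + 30 * G * j) *
      (G * (1 + 11 * G + 11 * G ^ 2 + 30 * G * j) + 8) *
      (4 * (G * (1 + 11 * G + 11 * G ^ 2 + 30 * G * j)) + 27)) →
    IsNegFundamentalDiscr (G * (1 + 11 * G + 11 * G ^ 2 + 30 * G * j) *
      (G * (1 + 11 * G + 11 * G ^ 2 + 30 * G * j) + 8) *
      (4 * (G * (1 + 11 * G + 11 * G ^ 2 + 30 * G * j)) + 27)) ∧
    ∃ a y : ℕ, 1 < a ∧
      4 * a < G * (1 + 11 * G + 11 * G ^ 2 + 30 * G * j) *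
        (G * (1 + 11 * G + 11 * G ^ 2 + 30 * G * j) + 8) *
        (4 * (G * (1 + 11 * G + 11 * G ^ 2 + 30 * G * j)) + 27) ∧
      y ^ 2 + G * (1 + 11 * G + 11 * G ^ 2 + 30 * G * j) *
        (G * (1 + 11 * G + 11 * G ^ 2 + 30 * G * j) + 8) *
        (4 * (G * (1 + 11 * G + 11 * G ^ 2 + 30 * G * j)) + 27) = 4 * a ^ 3 ∧
      Odd y

/-- STUB F statement — NAGELL 1922 (elementary; LEAD): a squarefree `d > 4a` with
`y² + d = 4a³`, `a > 1`, `y` odd, has `3 ∣ h(−d)`: the ideal `(a, (y+√−d)/2)` of `ℚ(√−d)` is a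
non-principal cube root of a principal ideal. -/
def NagellThreeTorsion : Prop :=
  ∀ (a y d : ℕ), 1 < a → 4 * a < d → Squarefree d → Odd y → y ^ 2 + d = 4 * a ^ 3 →
    3 ∣ BinaryQuadraticForm.classNumber (-(d : ℤ))

/-- STUB X statement — THE APEX (hypothesis-type, factoring family, NEVER staffed): squarefreeness
has no polynomial-size circuits (Adleman–McCurley open problem O8). -/
def SqfreeNotPPoly : Prop :=
  encodingNatBool.toLanguage {m : ℕ | Squarefree m} ∉ PPoly

/-! ## The registered OPEN stub: the apex (`sorry`); A–F are landed -/

/-- **STUB X · `stub_sqfreeNotPPoly`** (THE APEX; hypothesis-type, crux-sized — never staffed;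
registered so that the composition concludes the crux by name). -/
theorem stub_sqfreeNotPPoly :
    encodingNatBool.toLanguage {m : ℕ | Squarefree m} ∉ PPoly := by
  sorry

/-! ### Consistency: each named statement IS its registered stub (definitionally) -/

/-- CLOSED (p101148): `SamplerNagellFP` is the landed `stub_samplerNagellFP`. -/
theorem samplerNagellFP_holds : SamplerNagellFP := stub_samplerNagellFP
/-- CLOSED (p100537): `OneSidedNagell` is the landed `stub_oneSidedNagell`. -/
theorem oneSidedNagell_holds : OneSidedNagell := stub_oneSidedNagell
/-- CLOSED (p100632): `SqfreeProductNagell` is the landed `stub_sqfreeProductNagell`. -/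
theorem sqfreeProductNagell_holds : SqfreeProductNagell := stub_sqfreeProductNagell
/-- CLOSED (p89304): `ApSieve` is the landed `stub_apSieve`. -/
theorem apSieve_holds : ApSieve := stub_apSieve
/-- CLOSED (p100932): `DensityNagell` is the landed `stub_densityNagell`. -/
theorem densityNagell_holds : DensityNagell := stub_densityNagell
/-- CLOSED (p100631): `NagellData` is the landed `stub_nagellData`. -/
theorem nagellData_holds : NagellData := stub_nagellData
/-- CLOSED (p100799): `NagellThreeTorsion` is the landed `stub_nagellThreeTorsion`. -/
theorem nagellThreeTorsion_holds : NagellThreeTorsion := stub_nagellThreeTorsion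
/-- `SqfreeNotPPoly` is `stub_sqfreeNotPPoly`. -/
theorem sqfreeNotPPoly_holds : SqfreeNotPPoly := stub_sqfreeNotPPoly

/-! ### Name-keyed aliases of the statements (the hypotheses of the composition) -/
namespace Registered

/-- Alias of STUB X's statement keyed by the registered stub name. -/
abbrev stub_sqfreeNotPPoly : Prop := SqfreeNotPPoly

end Registered

/-! ## Proved glue -/

/-- The crux is literally `IQ3 ∉ P/poly` (definitional). -/
theorem iqThreeNotPPoly_iff : IqThreeNotPPoly ↔ iqThreeLang ∉ PPoly := Iff.rfl

/-- Unfolding of the sampler's closed form. -/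
theorem nD_eq (G j : ℕ) : nD G j = G * (1 + 11 * G + 11 * G ^ 2 + 30 * G * j) *
    (G * (1 + 11 * G + 11 * G ^ 2 + 30 * G * j) + 8) *
    (4 * (G * (1 + 11 * G + 11 * G ^ 2 + 30 * G * j)) + 27) := rfl

/-- Membership of a numeral in `IQ3`. -/
theorem encodeNat_mem_iqThreeLang_iff (d : ℕ) : encodeNat d ∈ iqThreeLang ↔ d ∈ iqThreeSet :=
  encodingNatBool.mem_toLanguage_iff iqThreeSet d

/-- Membership of a numeral in `SQF`. -/
theorem encodeNat_mem_sqfreeLang_iff (m : ℕ) : encodeNat m ∈ sqfreeLang ↔ Squarefree m :=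
  encodingNatBool.mem_toLanguage_iff {m : ℕ | Squarefree m} m

/-! ### Arithmetic of the core `G = N / gcd(N, 6)` -/

/-- `gcd(N, 6)` divides `N`, so `N = G · gcd(N, 6)`. -/
theorem core_mul_gcd (N : ℕ) : core N * Nat.gcd N 6 = N :=
  Nat.div_mul_cancel (Nat.gcd_dvd_left N 6)

/-- `G ∣ N`. -/
theorem core_dvd (N : ℕ) : core N ∣ N := ⟨Nat.gcd N 6, (core_mul_gcd N).symm⟩

/-- `G ≤ N`. -/
theorem core_le (N : ℕ) : core N ≤ N := Nat.div_le_self N _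

/-- `gcd(N, 6) ∣ 6`. -/
theorem gcd_six_dvd (N : ℕ) : Nat.gcd N 6 ∣ 6 := Nat.gcd_dvd_right N 6

/-- `0 < gcd(N, 6)`. -/
theorem gcd_six_pos (N : ℕ) : 0 < Nat.gcd N 6 := Nat.gcd_pos_of_pos_right N (by norm_num)

/-- For squarefree `N`: the core is squarefree, odd, prime to `3` and positive. -/
theorem core_facts {N : ℕ} (hN : Squarefree N) :
    Squarefree (core N) ∧ ¬ 2 ∣ core N ∧ ¬ 3 ∣ core N ∧ 0 < core N := by
  have hN0 : N ≠ 0 := fun h => by simp [h] at hN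
  have hmul := core_mul_gcd N
  have hsqG : Squarefree (core N) := by
    rw [← hmul] at hN
    exact Squarefree.of_mul_left hN
  have hpos : 0 < core N := by
    rcases Nat.eq_zero_or_pos (core N) with h | h
    · rw [h, zero_mul] at hmul; exact absurd hmul.symm hN0
    · exact h
  -- if `p ∈ {2, 3}` divided `G`, then `p ∣ gcd(N,6)` too (as `p ∣ N`, `p ∣ 6`), so `p² ∣ N`
  have key : ∀ p : ℕ, p.Prime → p ∣ 6 → ¬ p ∣ core N := by
    intro p hp hp6 hpG
    have hpN : p ∣ N := dvd_trans hpG (core_dvd N)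
    have hpg : p ∣ Nat.gcd N 6 := Nat.dvd_gcd hpN hp6
    have hp2 : p * p ∣ N := by
      rw [← hmul]; exact mul_dvd_mul hpG hpg
    have := hN p hp2
    exact hp.not_isUnit (by simpa using this)
  exact ⟨hsqG, key 2 Nat.prime_two (by norm_num), key 3 Nat.prime_three (by norm_num), hpos⟩

/-- For NON-squarefree `N`: the core has a square prime factor, or is even, or is divisible by `3`
(`p² ∣ N` with `p ≥ 5` survives in `G`; `9 ∣ N ⇒ 3 ∣ G`; `4 ∣ N ⇒ 2 ∣ G`; `N = 0 ⇒ G = 0`). -/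
theorem core_bad {N : ℕ} (hN : ¬ Squarefree N) :
    (∃ p : ℕ, p.Prime ∧ p ^ 2 ∣ core N) ∨ 2 ∣ core N ∨ 3 ∣ core N := by
  rcases Nat.eq_zero_or_pos N with rfl | hNpos
  · right; left; simp [core]
  obtain ⟨p, hp, hp2⟩ : ∃ p : ℕ, p.Prime ∧ p * p ∣ N := by
    by_contra hcon
    exact hN (Nat.squarefree_iff_prime_squarefree.2 fun p hp h => hcon ⟨p, hp, h⟩)
  -- `p * p ∣ N`
  have hmul := core_mul_gcd N
  have hg6 := gcd_six_dvd N
  by_cases hp6 : p ∣ 6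
  · -- `p = 2` or `p = 3`: `p² ∣ N = G · g` with `g ∣ 6` squarefree-ish ⇒ `p ∣ G`
    have hp23 : p = 2 ∨ p = 3 := by
      have : p ∣ 2 * 3 := by simpa using hp6
      rcases (Nat.Prime.dvd_mul hp).1 this with h | h
      · left; exact (Nat.prime_dvd_prime_iff_eq hp Nat.prime_two).1 h
      · right; exact (Nat.prime_dvd_prime_iff_eq hp Nat.prime_three).1 h
    have hpp : p * p ∣ core N * Nat.gcd N 6 := by rw [hmul]; exact hp2
    -- `p² ∤ gcd(N,6)` since `gcd ∣ 6` and `4 ∤ 6`, `9 ∤ 6`; so `p ∣ core N`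
    have hpG : p ∣ core N := by
      by_contra hcon
      have hcop : Nat.Coprime p (core N) := (Nat.Prime.coprime_iff_not_dvd hp).2 hcon
      have h1 : p * p ∣ Nat.gcd N 6 :=
        (Nat.Coprime.dvd_of_dvd_mul_left (Nat.Coprime.mul_left hcop hcop) hpp)
      have h2 : p * p ∣ 6 := dvd_trans h1 hg6
      rcases hp23 with rfl | rfl <;> omega
    rcases hp23 with rfl | rfl
    · right; left; exact hpG
    · right; right; exact hpG
  · -- `p ∤ 6`: `p` is coprime to `gcd(N,6)`, so `p² ∣ G`
    left
    refine ⟨p, hp, ?_⟩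
    have hcop : Nat.Coprime (p * p) (Nat.gcd N 6) := by
      have hc : Nat.Coprime p (Nat.gcd N 6) :=
        (Nat.Prime.coprime_iff_not_dvd hp).2 fun h => hp6 (dvd_trans h hg6)
      exact Nat.Coprime.mul_left hc hc
    have : p * p ∣ core N * Nat.gcd N 6 := by rw [hmul]; exact hp2
    rw [sq]
    exact hcop.dvd_of_dvd_mul_right this

/-- A squarefree output lands in `S` (STUBS E and F). -/
theorem nD_mem_iqThreeSet (hE : NagellData) (hF : NagellThreeTorsion) (G j : ℕ)
    (hsq : Squarefree (nD G j)) : nD G j ∈ iqThreeSet := by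
  obtain ⟨hfund, a, y, ha, h4a, hyd, hy⟩ := hE G j hsq
  exact ⟨hfund, hF a y _ ha h4a hsq hy hyd⟩

/-- `N < 2 ^ |bin N|`. -/
theorem lt_two_pow_length_encodeNat (N : ℕ) : N < 2 ^ (encodeNat N).length := by
  have h := bitsToNat_lt (encodeNat N)
  rwa [bitsToNat_encodeNat] at h

/-- Seeds ↔ numbers, for any decidability instance on the predicate (the landed
`card_filter_seeds` is stated with the classical one). -/
theorem card_filter_seeds' (ℓ : ℕ) (P : ℕ → Prop) [DecidablePred P] :
    (Finset.univ.filter (fun r : Fin ℓ → Bool => P (bitsToNat (List.ofFn r)))).card =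
      ((Finset.range (2 ^ ℓ)).filter (fun k => P k)).card := by
  convert card_filter_seeds ℓ P

/-! ## The composition: the stubs imply the crux, BY NAME (kernel-checked; no `sorry` below) -/

/-- **The RUR reduction `SQF ≤ IQ3` from STUBS A–F and the landed `NatAdapter`, `ApSieve`, fed to
the landed closure `mem_PPoly_of_rurReduction`: `IQ3 ∈ P/poly → SQF ∈ P/poly`.** Seeds of length
`ℓ(n) = 4n + 8`, success polynomial `q = 16 X + 32 ≥ max(4, ℓ)`. -/
theorem sqfreeLang_mem_PPoly_of (hA : SamplerNagellFP) (hB : OneSidedNagell)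
    (hC : SqfreeProductNagell) (hD : DensityNagell) (hE : NagellData) (hF : NagellThreeTorsion)
    (hIQ : iqThreeLang ∈ PPoly) : sqfreeLang ∈ PPoly := by
  obtain ⟨f, hf, hfval⟩ := hA
  obtain ⟨f', hf', hcanon, hjunk⟩ := stub_natAdapter f hf []
  obtain ⟨n₀, hdens⟩ := hD hC apSieve_holds
  refine mem_PPoly_of_rurReduction sqfreeLang iqThreeLang f' hf' (fun n => 4 * n + 8)
    (16 * Polynomial.X + 32) n₀ (fun n => ?_) ?_ ?_ hIQ
  · simp only [Polynomial.eval_add, Polynomial.eval_mul, Polynomial.eval_ofNat, Polynomial.eval_X]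
    omega
  · -- NO side (exact): non-squarefree numerals by STUB B, non-numerals by the guard
    intro x hx r
    by_cases hcx : ∃ m : ℕ, encodeNat m = x
    · obtain ⟨m, rfl⟩ := hcx
      have hm : ¬ Squarefree m := fun h => hx ((encodeNat_mem_sqfreeLang_iff m).2 h)
      rw [hcanon, hfval, bitsToNat_encodeNat, encodeNat_mem_iqThreeLang_iff]
      rintro ⟨hfund, -⟩
      exact hB (core m) (bitsToNat r) (core_bad hm) hfund
    · rw [hjunk x r (fun m hm => hcx ⟨m, hm⟩)]
      exact nil_not_mem_iqThreeLanguage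
  · -- YES side (density ≥ 1/4): STUB D on the core, and squarefree outputs are in `S` (E, F)
    intro x hx hn
    obtain ⟨N, hN, hNx⟩ := hx
    change encodeNat N = x at hNx
    subst hNx
    have hsq : Squarefree N := hN
    obtain ⟨hGsq, hG2, hG3, hGpos⟩ := core_facts hsq
    have hGlt : core N < 2 ^ (encodeNat N).length :=
      lt_of_le_of_lt (core_le N) (lt_two_pow_length_encodeNat N)
    have h := hdens (encodeNat N).length hn (core N) hGsq hG2 hG3 hGpos hGlt
    have hq : 4 ≤ (16 * Polynomial.X + 32 : Polynomial ℕ).eval (encodeNat N).length := by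
      simp only [Polynomial.eval_add, Polynomial.eval_mul, Polynomial.eval_ofNat, Polynomial.eval_X]
      omega
    refine h.trans ((Nat.mul_le_mul_right _ hq).trans (Nat.mul_le_mul_left _ ?_))
    rw [← card_filter_seeds' (4 * (encodeNat N).length + 8) (fun j => Squarefree
      (core N * (1 + 11 * core N + 11 * core N ^ 2 + 30 * core N * j) *
        (core N * (1 + 11 * core N + 11 * core N ^ 2 + 30 * core N * j) + 8) *
        (4 * (core N * (1 + 11 * core N + 11 * core N ^ 2 + 30 * core N * j)) + 27)))]
    refine Finset.card_le_card fun r hr => ?_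
    rw [Finset.mem_filter] at hr ⊢
    refine ⟨Finset.mem_univ _, ?_⟩
    rw [hcanon, hfval, bitsToNat_encodeNat, encodeNat_mem_iqThreeLang_iff]
    exact nD_mem_iqThreeSet hE hF (core N) _ hr.2

/-- **`IqThreeNotPPoly_of`** — the registered stubs give the crux BY NAME: if `IQ3 ∈ P/poly` then
`SQF ∈ P/poly` (`sqfreeLang_mem_PPoly_of`), contradicting the apex. -/
theorem IqThreeNotPPoly_of (hX : Registered.stub_sqfreeNotPPoly) :
    Summit.QuantumAdvantage.QuantumAdvantage.Theses.ArithStatLadder.IqThreeNotPPoly := by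
  rw [iqThreeNotPPoly_iff]
  intro hIQ
  exact hX (sqfreeLang_mem_PPoly_of samplerNagellFP_holds oneSidedNagell_holds
    sqfreeProductNagell_holds densityNagell_holds nagellData_holds nagellThreeTorsion_holds hIQ)

/-- Wiring check: the registered stubs feed `IqThreeNotPPoly_of` as stated. Deliberately an unnamed
`example`, so that `IqThreeNotPPoly_of` is the ONLY theorem of the file concluding the crux. -/
example : Summit.QuantumAdvantage.QuantumAdvantage.Theses.ArithStatLadder.IqThreeNotPPoly :=
  IqThreeNotPPoly_of stub_sqfreeNotPPoly

/-! ## By-product for the negative side (no apex): the UNCONDITIONAL refutation floor -/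

/-- **The refutation floor**: any refutation of the crux puts SQUAREFREES in `P/poly` — from STUB A
and the landed B–F only (no named fact, no apex). -/
theorem sqfree_mem_PPoly_of_not (h : ¬ IqThreeNotPPoly) : sqfreeLang ∈ PPoly :=
  sqfreeLang_mem_PPoly_of samplerNagellFP_holds oneSidedNagell_holds sqfreeProductNagell_holds
    densityNagell_holds nagellData_holds nagellThreeTorsion_holds
    (not_not.1 ((not_congr iqThreeNotPPoly_iff).1 h))

/-! ## The CONCLUSION (LANDED p106985 as `Theorems/ArithStatLadderIqThreeNotPPolyNagellSixFree.lean`)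

v4.2 registered this signature as a stub (with `sorry`) so that the concluding Theorems file could
land `--supports`; it HAS landed (p106985,
`Summit.QuantumAdvantage.QuantumAdvantage.Theorems.IqThreeNotPPoly.toLanguage_squarefree_mem_PPoly_of_iqThree_nagell`),
so v5 closes it here too — by this file's own cone (`sqfreeLang_mem_PPoly_of` over the six landed
stubs), keeping the skeleton independent of the farm's build of the new module. The registered stub
list is now the apex alone. The crux-from-apex implication is ALSO an accepted tree theorem by an
independent sampler (gen-1 lead, `Theorems/ArithStatLadderIqThreeNotPPolyNagell.lean`:
`iqThreeNotPPoly_of_sqfreeNotPPoly`), and the apex's status is kernel-checked in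
`Theorems/ArithStatLadderIqThreeNotPPolyApexNP.lean` (p108496: `SQUAREFUL ∈ NP`, hence
apex ⇒ `NP ⊄ P/poly`, `P ≠ NP`). -/

/-- CONCLUSION 1 (CLOSED — p106985 in the tree; here by the file's own cone):
`IQ3 ∈ P/poly → SQUAREFREES ∈ P/poly`, unconditionally. -/
theorem toLanguage_squarefree_mem_PPoly_of_iqThree_nagell :
    encodingNatBool.toLanguage
      {d : ℕ | IsNegFundamentalDiscr d ∧ 3 ∣ BinaryQuadraticForm.classNumber (-(d : ℤ))} ∈ PPoly →
    encodingNatBool.toLanguage {m : ℕ | Squarefree m} ∈ PPoly :=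
  fun hIQ => sqfreeLang_mem_PPoly_of samplerNagellFP_holds oneSidedNagell_holds
    sqfreeProductNagell_holds densityNagell_holds nagellData_holds nagellThreeTorsion_holds hIQ


/-! ## RUNG (c5): the apex's `AC⁰` shadow — `SQUAREFREES ∉ AC⁰` (Bernasconi–Damm–Shparlinski 2001)

The apex `SqfreeNotPPoly` is hypothesis-type; its constant-depth shadow is a THEOREM, earned here.
Average-sensitivity route (Boppana 1997 / Linial–Mansour–Nisan 1993), run through A. Tal's
Fourier-tail bound for `acBasis` circuits, which is PROVED in the tree
(`Literature.NumberTheory.Sieve.GreenAC0.tailWeight_circuit_le` = Tal 2017 Thm 3.6 via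
`ACForm.tailWeight_le_tailBound`; asymptotics `MobiusLadder.tail_term_eventually`):
* R1 `stub_influenceTail` — the truncated Fourier formula for total influence,
  `I[f] = Σ_S |S| f̂(S)² ≤ k + n · W^{≥k+1}[f]` (O'Donnell 2014, Prop. 2.? / §2.3);
* R2 `stub_influenceAC0` — hence (R1 ⇒) every depth-`d`, size-`p(n)` circuit over `acBasis` has
  `I ≤ δ n` eventually in `n` (take `k ≈ √n / log n`);
* R3 `stub_shiftPairsCount` — NUMBER THEORY: for `n ≥ n₀` and every position `n/2 + 8 ≤ j ≤ n − 2`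
  there are `≥ 2ⁿ/512` numerals `N ∈ [2^{n-1}, 2ⁿ)`, `N ≡ 3 (4)`, bit `j` of `N` zero, `N`
  squarefree and `9 ∣ N + 2ʲ` (AP squarefree sieve `stub_apSieve`, modulus `36`, in each of the
  `2^{n-2-j}` dyadic blocks; the `√(2ⁿ)` error is negligible because `j ≥ n/2 + 8`);
* R4 `stub_shiftPairsCube` — cube/numeral plumbing: each such `N` is a point of the cube where the
  language's indicator is sensitive to bit `j` (`N ↦ N + 2ʲ` flips bit `j` only).
Composition `squarefree_not_mem_AC0_of` (kernel-checked below): `I ≥ (n/2 − 10)/512` against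
`I ≤ n/2048`. v8: R1–R4 are LANDED and imported; `example` at the end is sorry-free.
-/

/-- RUNG STUB R1 statement: truncated Fourier formula for total influence on the cube. -/
def InfluenceTail : Prop :=
  ∀ (n k : ℕ) (f : (Fin n → Bool) → Bool),
    (∑ i : Fin n, ((Finset.univ.filter
        (fun x : Fin n → Bool => f x ≠ f (Function.update x i (!x i)))).card : ℝ)) / 2 ^ n
      ≤ k + n * LowDegree.tailWeight
        (fun x => Literature.Probability.RandomGraphs.LowDegree.sgn (f x)) (k + 1)

/-- RUNG STUB R2 statement: polynomial-size constant-depth circuits have total influence `o(n)`. -/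
def InfluenceAC0 : Prop :=
  ∀ (d : ℕ) (p : Polynomial ℕ) (δ : ℝ), 0 < δ →
    ∀ᶠ n : ℕ in Filter.atTop, ∀ C : Circuit (Fin n), C.IsOver acBasis → C.acDepth ≤ d →
      C.size ≤ p.eval n →
        (∑ i : Fin n, ((Finset.univ.filter
          (fun x : Fin n → Bool => C.eval x ≠ C.eval (Function.update x i (!x i)))).card : ℝ)) /
            2 ^ n ≤ δ * n

/-- RUNG STUB R3 statement: many squarefree numerals whose bit-`j` shift is divisible by `9`. -/
def ShiftPairsCount : Prop :=
  ∃ n₀ : ℕ, ∀ n : ℕ, n₀ ≤ n → ∀ j : ℕ, n + 16 ≤ 2 * j → j + 2 ≤ n →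
    2 ^ n ≤ 512 * ((Finset.range (2 ^ n)).filter (fun N : ℕ =>
      2 ^ (n - 1) ≤ N ∧ N % 4 = 3 ∧ N.testBit j = false ∧ Squarefree N ∧ 9 ∣ N + 2 ^ j)).card

/-- RUNG STUB R4 statement: shifted pairs in `A ⊆ ℕ` are bit-`j`-sensitive points of `bin A`. -/
def ShiftPairsCube : Prop :=
  ∀ (n : ℕ) (j : Fin n) (A : Set ℕ),
    ((Finset.range (2 ^ n)).filter (fun N : ℕ =>
        2 ^ (n - 1) ≤ N ∧ N.testBit j = false ∧ N ∈ A ∧ N + 2 ^ (j : ℕ) ∉ A)).card ≤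
      (Finset.univ.filter (fun x : Fin n → Bool =>
        (encodingNatBool.toLanguage A).boolIndicator (List.ofFn x) ≠
          (encodingNatBool.toLanguage A).boolIndicator
            (List.ofFn (Function.update x j (!x j))))).card

/-- RUNG STUB R5 statement (c5 wave 2): as R3 with `5 ∣ N` planted (so `N` is composite: the
`ℓ = 2` language needs `ω(N) ≥ 2`), positions `j ≥ n/2 + 12`, constant `16384`. -/
def ShiftPairsCountFive : Prop :=
  ∃ n₀ : ℕ, ∀ n : ℕ, n₀ ≤ n → ∀ j : ℕ, n + 24 ≤ 2 * j → j + 2 ≤ n →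
    2 ^ n ≤ 16384 * ((Finset.range (2 ^ n)).filter (fun N : ℕ =>
      2 ^ (n - 1) ≤ N ∧ N % 4 = 3 ∧ N.testBit j = false ∧ Squarefree N ∧ 5 ∣ N ∧
        9 ∣ N + 2 ^ j)).card

/-! ### The five rung stubs are LANDED (waves 1–2 of c5); each named statement IS its stub -/

/-- CLOSED (p122608): `InfluenceTail` is the landed `stub_influenceTail`. -/
theorem influenceTail_holds : InfluenceTail := stub_influenceTail
/-- CLOSED (p122737 ∘ p122608): `InfluenceAC0` by the landed `stub_influenceAC0` fed with `stub_influenceTail`. -/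
theorem influenceAC0_holds : InfluenceAC0 := stub_influenceAC0 stub_influenceTail
/-- CLOSED (p123405): `ShiftPairsCount` is the landed `stub_shiftPairsCount`. -/
theorem shiftPairsCount_holds : ShiftPairsCount := stub_shiftPairsCount
/-- CLOSED (p122947): `ShiftPairsCube` is the landed `stub_shiftPairsCube`. -/
theorem shiftPairsCube_holds : ShiftPairsCube := stub_shiftPairsCube
/-- CLOSED (p124143): `ShiftPairsCountFive` is the landed `stub_shiftPairsCountFive`. -/
theorem shiftPairsCountFive_holds : ShiftPairsCountFive := stub_shiftPairsCountFive

namespace Registered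
/-- Alias of R1's statement keyed by the registered stub name. -/
abbrev stub_influenceTail : Prop := InfluenceTail
/-- Alias of R2's statement keyed by the registered stub name. -/
abbrev stub_influenceAC0 : Prop := InfluenceTail → InfluenceAC0
/-- Alias of R3's statement keyed by the registered stub name. -/
abbrev stub_shiftPairsCount : Prop := ShiftPairsCount
/-- Alias of R4's statement keyed by the registered stub name. -/
abbrev stub_shiftPairsCube : Prop := ShiftPairsCube
/-- Alias of R5's statement keyed by the registered stub name. -/
abbrev stub_shiftPairsCountFive : Prop := ShiftPairsCountFive
end Registered

/-- `9 ∣ m` kills squarefreeness. -/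
theorem not_squarefree_of_nine_dvd {m : ℕ} (h : 9 ∣ m) : ¬ Squarefree m := by
  intro hsq
  have h33 : 3 * 3 ∣ m := by simpa using h
  have := hsq 3 h33
  norm_num at this

/-- **THE RUNG, composed (kernel-checked): generic core.** From R2 (`InfluenceAC0`) and R4
(`ShiftPairsCube`): if for all large `n` and every position `(n + w)/2 ≤ j ≤ n − 2` a set `good n j`
of `≥ 2ⁿ/K` numerals `N < 2ⁿ` with `2^{n-1} ≤ N`, bit `j` zero, `N ∈ A`, `N + 2ʲ ∉ A` is given, then
`bin A ∉ AC⁰` — a deciding family has total influence `≤ n/(4K)` at a large length `n`, but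
`≥ ((n − w − 3)/2) / K` from the good positions; contradiction for `n > 2w + 6`. -/
theorem not_mem_AC0_of_sensitive_numerals (h2 : InfluenceAC0) (h4 : ShiftPairsCube)
    (A : Set ℕ) (K w : ℕ) (hK : 0 < K) (good : ℕ → ℕ → Finset ℕ)
    (hgood : ∀ n j : ℕ, good n j ⊆ (Finset.range (2 ^ n)).filter (fun N : ℕ =>
      2 ^ (n - 1) ≤ N ∧ N.testBit j = false ∧ N ∈ A ∧ N + 2 ^ j ∉ A))
    (hcount : ∃ n₀ : ℕ, ∀ n : ℕ, n₀ ≤ n → ∀ j : ℕ, n + w ≤ 2 * j → j + 2 ≤ n →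
      2 ^ n ≤ K * (good n j).card) :
    encodingNatBool.toLanguage A ∉ AC0 := by
  rintro ⟨d, p, C, hC, hdec⟩
  obtain ⟨n₀, h3⟩ := hcount
  have hKR : (0 : ℝ) < K := by exact_mod_cast hK
  have hev := h2 d p (1 / (4 * K)) (by positivity)
  obtain ⟨n, ⟨hn₀, hn64⟩, hI⟩ :=
    (((Filter.eventually_ge_atTop n₀).and (Filter.eventually_ge_atTop (2 * w + 64))).and hev).exists
  have hIn := hI (C n) (hC n).1 (hC n).2.1 (hC n).2.2
  set c : Fin n → ℝ := fun i => ((Finset.univ.filter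
      (fun x : Fin n → Bool => (C n).eval x ≠ (C n).eval (Function.update x i (!x i)))).card : ℝ)
    with hc
  have hc0 : ∀ i, 0 ≤ c i := fun i => by rw [hc]; positivity
  have hpos : ∀ i : Fin n, n + w ≤ 2 * (i : ℕ) → (i : ℕ) + 2 ≤ n → (2 : ℝ) ^ n / K ≤ c i := by
    intro i hi1 hi2
    have hA := h3 n hn₀ i hi1 hi2
    have hB := h4 n i A
    have e : ∀ u : Fin n → Bool, (C n).eval u =
        (encodingNatBool.toLanguage A).boolIndicator (List.ofFn u) := fun u => hdec.eval_eq u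
    have hnat : 2 ^ n ≤ K * (Finset.univ.filter (fun x : Fin n → Bool =>
        (C n).eval x ≠ (C n).eval (Function.update x i (!x i)))).card := by
      refine hA.trans (Nat.mul_le_mul_left K
        (le_trans (Finset.card_le_card (hgood n i)) (hB.trans (le_of_eq ?_))))
      simp only [e]
    have hreal : (2 : ℝ) ^ n ≤ K * c i := by
      show (2 : ℝ) ^ n ≤ K * ((Finset.univ.filter (fun x : Fin n → Bool =>
        (C n).eval x ≠ (C n).eval (Function.update x i (!x i)))).card : ℝ)
      exact_mod_cast hnat
    rw [div_le_iff₀ hKR]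
    linarith
  set a : ℕ := (n + w + 1) / 2 with ha
  have ha2 : 2 * a ≤ n + w + 1 := by omega
  set J : Finset (Fin n) := (Finset.Ico a (n - 1)).attachFin (fun m hm => by
      rw [Finset.mem_Ico] at hm; omega) with hJ
  have hJcard : J.card = n - 1 - a := by rw [hJ, Finset.card_attachFin, Nat.card_Ico]
  have hJmem : ∀ i ∈ J, n + w ≤ 2 * (i : ℕ) ∧ (i : ℕ) + 2 ≤ n := by
    intro i hi
    rw [hJ, Finset.mem_attachFin, Finset.mem_Ico] at hi
    omega
  have hlow : (J.card : ℝ) * ((2 : ℝ) ^ n / K) ≤ ∑ i : Fin n, c i := by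
    calc (J.card : ℝ) * ((2 : ℝ) ^ n / K) = ∑ i ∈ J, (2 : ℝ) ^ n / K := by
          rw [Finset.sum_const, nsmul_eq_mul]
      _ ≤ ∑ i ∈ J, c i := Finset.sum_le_sum fun i hi => hpos i (hJmem i hi).1 (hJmem i hi).2
      _ ≤ ∑ i : Fin n, c i :=
          Finset.sum_le_sum_of_subset_of_nonneg (Finset.subset_univ J) fun i _ _ => hc0 i
  have hup : (∑ i : Fin n, c i) / 2 ^ n ≤ 1 / (4 * K) * n := by simpa [hc] using hIn
  have h2n : (0 : ℝ) < 2 ^ n := by positivity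
  rw [div_le_iff₀ h2n] at hup
  have hcardR : ((n : ℝ) - 1 - a) = (J.card : ℝ) := by
    rw [hJcard]
    push_cast [Nat.cast_sub (show a ≤ n - 1 by omega), Nat.cast_sub (show 1 ≤ n by omega)]
    ring
  have ha2R : 2 * (a : ℝ) ≤ n + w + 1 := by exact_mod_cast ha2
  have hn64R : 2 * (w : ℝ) + 64 ≤ n := by exact_mod_cast hn64
  have hT : (2 : ℝ) ^ n = K * ((2 : ℝ) ^ n / K) := by field_simp
  set T : ℝ := (2 : ℝ) ^ n / K with hTdef
  have hT0 : 0 < T := by rw [hTdef]; positivity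
  have hup' : ∑ i : Fin n, c i ≤ (n : ℝ) / 4 * T := by
    rw [hT] at hup
    have : 1 / (4 * (K : ℝ)) * n * (K * T) = (n : ℝ) / 4 * T := by field_simp
    linarith [hup, this]
  have P1 : 0 ≤ ((n : ℝ) + w + 1 - 2 * a) * T := mul_nonneg (by linarith) hT0.le
  have P2 : 0 ≤ ((n : ℝ) - 2 * w - 64) * T := mul_nonneg (by linarith) hT0.le
  have P3 : ((n : ℝ) - 1 - a) * T = (J.card : ℝ) * T := by rw [hcardR]
  linarith [hlow, hup', P1, P2, P3, hT0]

/-- `4 ∣ 2ʲ` for `j ≥ 2`, as `(N + 2ʲ) % 4 = N % 4`. -/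
theorem add_two_pow_mod_four {N j : ℕ} (hj : 2 ≤ j) : (N + 2 ^ j) % 4 = N % 4 := by
  obtain ⟨t, rfl⟩ := Nat.exists_eq_add_of_le hj
  rw [pow_add]
  omega

/-- **R2, R3, R4 ⇒ `SQUAREFREES ∉ AC⁰`** (core with `A = {squarefree}`, `K = 512`, `w = 16`,
`good` = the R3 set: `N` squarefree is in `A`; `N + 2ʲ` is a multiple of `9`, not squarefree). -/
theorem squarefree_not_mem_AC0_of (h2 : InfluenceAC0) (h3 : ShiftPairsCount)
    (h4 : ShiftPairsCube) : encodingNatBool.toLanguage {m : ℕ | Squarefree m} ∉ AC0 := by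
  refine not_mem_AC0_of_sensitive_numerals h2 h4 {m : ℕ | Squarefree m} 512 16 (by norm_num)
    (fun n j => (Finset.range (2 ^ n)).filter (fun N : ℕ =>
        2 ^ (n - 1) ≤ N ∧ N % 4 = 3 ∧ N.testBit j = false ∧ Squarefree N ∧ 9 ∣ N + 2 ^ j))
    (fun n j N hN => ?_) h3
  simp only [Finset.mem_filter, Set.mem_setOf_eq] at hN ⊢
  obtain ⟨hr, h1, -, h3', h4', h5⟩ := hN
  exact ⟨hr, h1, h3', h4', not_squarefree_of_nine_dvd h5⟩

/-- **R2, R5, R4 ⇒ the `ℓ = 2` ANALOGUE OF THE CRUX HOLDS AGAINST `AC⁰`**: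
`bin {d : −d fundamental ∧ 2 ∣ h(−d)} ∉ AC⁰` (core with `K = 16384`, `w = 24`, `good` = the R5 set;
genus theory `two_dvd_classNumber_iff_not`: for fundamental `−d`, `2 ∣ h(−d) ↔ ¬(d = 4 ∨ d = 8 ∨ d
prime)`, and a squarefree `N ≡ 3 (4)` with `5 ∣ N` is fundamental and not prime; `N + 2ʲ ≡ 3 (4)`
with `9 ∣ N + 2ʲ` is not fundamental). -/
theorem iqTwo_not_mem_AC0_of (h2 : InfluenceAC0) (h5 : ShiftPairsCountFive) (h4 : ShiftPairsCube) :
    encodingNatBool.toLanguage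
      {d : ℕ | IsNegFundamentalDiscr d ∧ 2 ∣ BinaryQuadraticForm.classNumber (-(d : ℤ))} ∉ AC0 := by
  refine not_mem_AC0_of_sensitive_numerals h2 h4 _ 16384 24 (by norm_num)
    (fun n j => if 2 ≤ j then (Finset.range (2 ^ n)).filter (fun N : ℕ =>
        2 ^ (n - 1) ≤ N ∧ N % 4 = 3 ∧ N.testBit j = false ∧ Squarefree N ∧ 5 ∣ N ∧
          9 ∣ N + 2 ^ j) else ∅)
    (fun n j N hN => ?_) ?_
  · by_cases hj : 2 ≤ j
    · rw [if_pos hj] at hN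
      simp only [Finset.mem_filter, Set.mem_setOf_eq] at hN ⊢
      obtain ⟨hr, h1, hm4, h3', hsq, h5N, h9⟩ := hN
      have hF : IsNegFundamentalDiscr N := (isNegFundamentalDiscr_iff_squarefree_of_mod_four hm4).2 hsq
      refine ⟨hr, h1, h3', ⟨hF, (Summit.QuantumAdvantage.QuantumAdvantage.Theorems.IqThreeNotPPoly.Negative.two_dvd_classNumber_iff_not
          hF).2 ?_⟩, ?_⟩
      · rintro (h | h | hp)
        · omega
        · omega
        · have h5' := (Nat.Prime.eq_one_or_self_of_dvd hp 5 h5N)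
          omega
      · rintro ⟨hF', -⟩
        have hm4' : (N + 2 ^ j) % 4 = 3 := by rw [add_two_pow_mod_four hj]; exact hm4
        exact not_squarefree_of_nine_dvd h9
          ((isNegFundamentalDiscr_iff_squarefree_of_mod_four hm4').1 hF')
    · rw [if_neg hj] at hN
      exact absurd hN (Finset.notMem_empty N)
  · obtain ⟨n₀, h⟩ := h5
    refine ⟨n₀, fun n hn j hj1 hj2 => ?_⟩
    rw [if_pos (by omega)]
    exact h n hn j hj1 hj2

/-- Wiring check for the rung (sorry-free in v8): the LANDED stubs give `SQUAREFREES ∉ AC⁰`. -/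
example : encodingNatBool.toLanguage {m : ℕ | Squarefree m} ∉ AC0 :=
  squarefree_not_mem_AC0_of influenceAC0_holds shiftPairsCount_holds shiftPairsCube_holds

/-- Wiring check for wave 2 (sorry-free in v9): R5 gives the `ℓ = 2` analogue against `AC⁰`. -/
example : encodingNatBool.toLanguage
    {d : ℕ | IsNegFundamentalDiscr d ∧ 2 ∣ BinaryQuadraticForm.classNumber (-(d : ℤ))} ∉ AC0 :=
  iqTwo_not_mem_AC0_of influenceAC0_holds shiftPairsCountFive_holds shiftPairsCube_holds

end Summit.QuantumAdvantage.QuantumAdvantage.Cruxes.IqThreeNotPPoly.Sketch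

end
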